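import Summits.BirchSwinnertonDyer.BirchSwinnertonDyer.Theorems.ErratumRoadFiveIMCDivClassicalBGuardedInvFromThm124bTransfer
import HarnessLib

/-!
# ROAD B12 at `p ≥ 5` (route `ErratumRoadFive`, classical-data residuals 19702 ∕ 19282 ∕ 19703), PART 2: the
# classical B-atom's DISPLAY (2.4)∃♭ᴮ at every admissible field `K ≠ ℚ(√−3)` — from FRAME + UB♯|ᵍ + INV|ᵍ, and
# from {Burungale–Castella–Skinner 2025 Thm 1.2.4 (b), Prop 4.2.2} + FRAME + UB♯|ᵍ + TRANSFER|ᵍ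

Cell `bsd-stepL` (run/shared/lean/pub/bsd-stepL/), seat `bsd-stepL-bdp` (prover g24, 2026-08-27). `--supports
stmt-BirchSwinnertonDyer-19702 --as helper`. THEOREMS ONLY (no definition, no named fact, no `sorry`). Memo:
HOME/proof/PROOF-BDP.md §57 (57.1, 57.10, 57.12) and §60. Companion of PART 1
(`ErratumRoadFiveIMCDivClassicalBGuardedInvFromThm124bTransfer.lean`: INV|ᵍ ⟸ {Thm 1.2.4 (b), Prop 4.2.2, UB♯|ᵍ,
TRANSFER|ᵍ}; the guard, the binders and the four hypotheses are explained there).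

THE SHAPE PROVED HERE is the body of bdp g16's atom `P2.IMCDivSomeFrameOnTreeB W p` (p498117) with ONE extra
binder `NumberField.discr K ≠ -3` right after `Odd (NumberField.discr K)`: at every such classical Heegner datum
THERE IS an `𝓞_{ℂ_p}⟦T⟧`-frame `(Ω_K ≠ 0, ‖Ω_p‖ = 1, Q)` with Castella's interpolation property at `(ι′, 𝔭_{ι′})`
such that `Ch_Λ(X_ac 𝔭bar)·𝓞_{ℂ_p}⟦T⟧ ⊆ (Q)` at every X-slot `𝔭bar ∋ p`, `𝔭bar ≠ 𝔭_{ι′}` — STRICTLY WEAKER than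
the atom (which also serves `K = ℚ(√−3)` when `p ≡ 1 (mod 3)` and every `ℓ ∣ N` is `≡ 1 (mod 3)`; PROOF-BDP 57.12).

* §3 `P2.imcDivSomeFrameB_guarded_of_unrFrame_of_upperDivisibility_of_invariantsMatch` — from FRAME (p507771's
  binder VERBATIM, unguarded: an `R₀`-frame at `(ι′, 𝔭_{ι′})`; print on every pair by Hsieh 2014 Thm 5.6 + BDP13
  Thm 5.5, p512577 — not imported here to stay clear of the route cone) + UB♯|ᵍ + INV|ᵍ: at each slot the
  EQUALITY `Ch·R₀⟦T⟧ = (L)` (p507771's `P2.charIdeal_map_eq_span_of_ratUpperBound_of_invariantsMatch`), read in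
  `𝓞_{ℂ_p}⟦T⟧` by p507771's last mile `P2.exists_intFrame_forall_of_unrFrame_of_forall_le`.
* §4 `P2.imcDivSomeFrameB_guarded_of_thm124b_of_unrFrame_of_upperDivisibility_of_transfer` — from the two PRINT
  facts + FRAME + UB♯|ᵍ + TRANSFER|ᵍ (PART 1 §1 supplies INV|ᵍ; §3 composes). So along ROAD B12 the deciding
  UNPRINTED content of the classical residuals at `p ≥ 5`, `K ≠ ℚ(√−3)`, is UB♯ + TRANSFER exactly — UB♯
  memo-proved (PROOF-BDP §55, refereed g44–g54), TRANSFER memo-proved (§40 ∕ §37.11 ∕ §58) with a partner existing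
  exactly on the finite-flat locus `p ∣ v_p(Δ_min)` (57.2: 40 799 class-wide pairs, all 3 687 of 19702).

HONEST FRAMING: CONDITIONAL theorems on two named PRINT facts (flag D1 on Thm 1.2.4) and three OPEN typed shapes;
nothing is discharged, booked or re-labelled (T7); no registered stub is matched (guard); BSD is proved for no pair.

References: arXiv:2405.00270v2 = IMRN 2025 rnaf082, Thm. 1.2.4 (b), Prop. 4.2.2; [Castella2018] Thm. 3.1;
[Castella2018Erratum] (2.4); [Washington1997] §7.1 Prop. 7.2, §13.2; [EmertonPollackWeston2006] Thm. 1;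
PROOF-BDP §37, §40, §55, §57, §60.
-/

set_option autoImplicit false

noncomputable section

open scoped Classical NumberField

open WeierstrassCurve NumberField IsDedekindDomain Field PowerSeries
open Literature.NumberTheory.EllipticCurves Literature.NumberTheory.EllipticCurves.GreenbergSelmer
open Literature.NumberTheory.EllipticCurves.ModularForms
open Literature.NumberTheory.EllipticCurves.Rank1Residual
open Literature.NumberTheory.EllipticCurves.Castella2018
open Literature.NumberTheory.GaloisRepresentations Literature.NumberTheory.GaloisCohomology
open Summit.BirchSwinnertonDyer.Rank1Residual.X11b.AcSelmer
open Summit.BirchSwinnertonDyer.Rank1Residual.X11b.Halves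
open Summit.BirchSwinnertonDyer.Rank1Residual.X1.KellerYinHalves
open Summit.BirchSwinnertonDyer.BirchSwinnertonDyer.Theorems
open Summit.BirchSwinnertonDyer.BirchSwinnertonDyer.Theorems.LambdaMatching
open Summit.BirchSwinnertonDyer.BirchSwinnertonDyer.Theorems.UniversalToricDescentTwinSplit
open Summit.BirchSwinnertonDyer.BirchSwinnertonDyer.Theorems.SchneiderFree

namespace Summit.BirchSwinnertonDyer.Rank1Residual.X11b

variable {W : WeierstrassCurve ℚ} [W.IsElliptic] {p : ℕ} [Fact p.Prime]

/-! ### §3 The atom's display at every guarded datum ⟸ FRAME + UB♯|ᵍ + INV|ᵍ -/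

omit [W.IsElliptic] in
/-- **(2.4)∃♭ᴮ at every admissible `K ≠ ℚ(√−3)` ⟸ FRAME + UB♯|ᵍ + INV|ᵍ** — the body of the classical B-atom
`P2.IMCDivSomeFrameOnTreeB W p` with the one extra binder `NumberField.discr K ≠ -3`: at every guarded datum
THERE IS an `𝓞_{ℂ_p}⟦T⟧`-frame `(Ω_K ≠ 0, ‖Ω_p‖ = 1, Q)` with Castella's interpolation property at `(ι′, 𝔭_{ι′})`
dividing `Ch_Λ(X_ac 𝔭bar)` at every X-slot `𝔭bar ≠ 𝔭_{ι′}`. FRAME is p507771's binder VERBATIM (unguarded; the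
guard is idle for it); at each slot UB♯ + INV give the EQUALITY `Ch·R₀⟦T⟧ = (L)` (p507771's
`P2.charIdeal_map_eq_span_of_ratUpperBound_of_invariantsMatch`), read in `𝓞_{ℂ_p}⟦T⟧` by p507771's last mile.
CONDITIONAL on the three shapes; STRICTLY WEAKER than the atom (guard); nothing booked.
[cite: Castella2018Erratum, (2.4) (p. 4) (the atom's display)] [cite: Castella2018, Thm. 3.1 (arXiv:1704.06608 p. 9)]
[cite: Washington1997, §7.1 Prop. 7.2 and §13.2] -/
theorem P2.imcDivSomeFrameB_guarded_of_unrFrame_of_upperDivisibility_of_invariantsMatch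
    (hFRAME : ∀ (N : ℕ) [NeZero N] (K : Type) [Field K] [NumberField K]
      (Dt : ModularParametrizationData W N) (H : HeegnerDatum N (NumberField.discr K)) (ι : K →+* ℂ)
      (P : (W.baseChange K).toAffine.Point),
      ClassX11b W p → 5 ≤ p → Surj W p → W.conductorNorm ℤ = N → IsImaginaryQuadratic K →
      Odd (NumberField.discr K) → ¬ (p : ℤ) ∣ NumberField.discr K → ¬ p ∣ Units.torsionOrder K →
      SatisfiesHeegnerHypothesis N K →
      (W.quadraticTwist (NumberField.discr K : ℚ)).entireLFunction 1 ≠ 0 →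
      WeierstrassCurve.Affine.Point.map ι.toRatAlgHom P = heegnerPointComplex Dt H →
      ¬ (p : ℤ) ∣ Dt.c → ¬ IsOfFinAddOrder P →
      ∀ (κ : ZpExtension K p), κ.IsAnticyclotomic →
        ∀ (γ : Field.absoluteGaloisGroup K) [Fact (κ.IsTopGenerator γ)]
          (ι' : PadicAlgCl p ≃+* ℂ) (w₀ : InfinitePlace K) (P' : (W.baseChange K).toAffine.Point),
          WeierstrassCurve.Affine.Point.map w₀.embedding.toRatAlgHom P' = heegnerPointComplex Dt H →
          ∀ (e : K →+* ℚ_[p]),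
            (∀ k : 𝓞 K, k ∈ (primeOfEmbeddingDatum p ι' w₀.embedding).asIdeal ↔ ‖e (k : K)‖ < 1) →
            ∃ (ΩK : ℂ) (Ωp : (unrIntegers p)ˣ) (L : UnrSeries p), ΩK ≠ 0 ∧
              IsBDPLFunction ι' (primeOfEmbeddingDatum p ι' w₀.embedding) κ γ Dt.f ΩK
                ((Ωp : unrIntegers p) : ℂ_[p]) L)
    (hUB : ∀ (N : ℕ) [NeZero N] (K : Type) [Field K] [NumberField K]
      (Dt : ModularParametrizationData W N) (H : HeegnerDatum N (NumberField.discr K)) (ι : K →+* ℂ)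
      (P : (W.baseChange K).toAffine.Point),
      ClassX11b W p → 5 ≤ p → Surj W p → W.conductorNorm ℤ = N → IsImaginaryQuadratic K →
      Odd (NumberField.discr K) → NumberField.discr K ≠ -3 → ¬ (p : ℤ) ∣ NumberField.discr K →
      ¬ p ∣ Units.torsionOrder K → SatisfiesHeegnerHypothesis N K →
      (W.quadraticTwist (NumberField.discr K : ℚ)).entireLFunction 1 ≠ 0 →
      WeierstrassCurve.Affine.Point.map ι.toRatAlgHom P = heegnerPointComplex Dt H →
      ¬ (p : ℤ) ∣ Dt.c → ¬ IsOfFinAddOrder P →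
      ∀ (κ : ZpExtension K p), κ.IsAnticyclotomic →
        ∀ (γ : Field.absoluteGaloisGroup K) [Fact (κ.IsTopGenerator γ)]
          (ι' : PadicAlgCl p ≃+* ℂ) (w₀ : InfinitePlace K) (P' : (W.baseChange K).toAffine.Point),
          WeierstrassCurve.Affine.Point.map w₀.embedding.toRatAlgHom P' = heegnerPointComplex Dt H →
          ∀ (e : K →+* ℚ_[p]),
            (∀ k : 𝓞 K, k ∈ (primeOfEmbeddingDatum p ι' w₀.embedding).asIdeal ↔ ‖e (k : K)‖ < 1) →
            ∀ (ΩK : ℂ) (Ωp : (unrIntegers p)ˣ) (L : UnrSeries p), ΩK ≠ 0 →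
              IsBDPLFunction ι' (primeOfEmbeddingDatum p ι' w₀.embedding) κ γ Dt.f ΩK
                ((Ωp : unrIntegers p) : ℂ_[p]) L →
              ∀ (𝔭bar : HeightOneSpectrum (𝓞 K)), ((p : ℕ) : 𝓞 K) ∈ 𝔭bar.asIdeal →
                𝔭bar ≠ primeOfEmbeddingDatum p ι' w₀.embedding →
                L ∈ (XAc.charIdeal (W.baseChange K) p κ 𝔭bar ∅ γ).map (PowerSeries.map (toUnr p)))
    (hINV : ∀ (N : ℕ) [NeZero N] (K : Type) [Field K] [NumberField K]
      (Dt : ModularParametrizationData W N) (H : HeegnerDatum N (NumberField.discr K)) (ι : K →+* ℂ)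
      (P : (W.baseChange K).toAffine.Point),
      ClassX11b W p → 5 ≤ p → Surj W p → W.conductorNorm ℤ = N → IsImaginaryQuadratic K →
      Odd (NumberField.discr K) → NumberField.discr K ≠ -3 → ¬ (p : ℤ) ∣ NumberField.discr K →
      ¬ p ∣ Units.torsionOrder K → SatisfiesHeegnerHypothesis N K →
      (W.quadraticTwist (NumberField.discr K : ℚ)).entireLFunction 1 ≠ 0 →
      WeierstrassCurve.Affine.Point.map ι.toRatAlgHom P = heegnerPointComplex Dt H →
      ¬ (p : ℤ) ∣ Dt.c → ¬ IsOfFinAddOrder P →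
      ∀ (κ : ZpExtension K p), κ.IsAnticyclotomic →
        ∀ (γ : Field.absoluteGaloisGroup K) [Fact (κ.IsTopGenerator γ)]
          (ι' : PadicAlgCl p ≃+* ℂ) (w₀ : InfinitePlace K) (P' : (W.baseChange K).toAffine.Point),
          WeierstrassCurve.Affine.Point.map w₀.embedding.toRatAlgHom P' = heegnerPointComplex Dt H →
          ∀ (e : K →+* ℚ_[p]),
            (∀ k : 𝓞 K, k ∈ (primeOfEmbeddingDatum p ι' w₀.embedding).asIdeal ↔ ‖e (k : K)‖ < 1) →
            ∀ (ΩK : ℂ) (Ωp : (unrIntegers p)ˣ) (L : UnrSeries p), ΩK ≠ 0 →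
              IsBDPLFunction ι' (primeOfEmbeddingDatum p ι' w₀.embedding) κ γ Dt.f ΩK
                ((Ωp : unrIntegers p) : ℂ_[p]) L →
              ∀ (𝔭bar : HeightOneSpectrum (𝓞 K)), ((p : ℕ) : 𝓞 K) ∈ 𝔭bar.asIdeal →
                𝔭bar ≠ primeOfEmbeddingDatum p ι' w₀.embedding →
                ∃ (g : IwasawaAlgebra p) (n : ℕ),
                  XAc.charIdeal (W.baseChange K) p κ 𝔭bar ∅ γ = Ideal.span {g} ∧
                  (‖((coeff n (PowerSeries.map (toUnr p) g) : unrIntegers p) : ℂ_[p])‖ = 1 ∧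
                    ∀ i < n, ‖((coeff i (PowerSeries.map (toUnr p) g) : unrIntegers p) : ℂ_[p])‖ < 1) ∧
                  (‖((coeff n L : unrIntegers p) : ℂ_[p])‖ = 1 ∧
                    ∀ i < n, ‖((coeff i L : unrIntegers p) : ℂ_[p])‖ < 1)) :
    ∀ (N : ℕ) [NeZero N] (K : Type) [Field K] [NumberField K]
      (Dt : ModularParametrizationData W N) (H : HeegnerDatum N (NumberField.discr K)) (ι : K →+* ℂ)
      (P : (W.baseChange K).toAffine.Point),
      ClassX11b W p → 5 ≤ p → Surj W p → W.conductorNorm ℤ = N → IsImaginaryQuadratic K →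
      Odd (NumberField.discr K) → NumberField.discr K ≠ -3 → ¬ (p : ℤ) ∣ NumberField.discr K →
      ¬ p ∣ Units.torsionOrder K → SatisfiesHeegnerHypothesis N K →
      (W.quadraticTwist (NumberField.discr K : ℚ)).entireLFunction 1 ≠ 0 →
      WeierstrassCurve.Affine.Point.map ι.toRatAlgHom P = heegnerPointComplex Dt H →
      ¬ (p : ℤ) ∣ Dt.c → ¬ IsOfFinAddOrder P →
      ∀ (κ : ZpExtension K p), κ.IsAnticyclotomic →
        ∀ (γ : Field.absoluteGaloisGroup K) [Fact (κ.IsTopGenerator γ)]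
          (ι' : PadicAlgCl p ≃+* ℂ) (w₀ : InfinitePlace K) (P' : (W.baseChange K).toAffine.Point),
          WeierstrassCurve.Affine.Point.map w₀.embedding.toRatAlgHom P' = heegnerPointComplex Dt H →
          ∀ (e : K →+* ℚ_[p]),
            (∀ k : 𝓞 K, k ∈ (primeOfEmbeddingDatum p ι' w₀.embedding).asIdeal ↔ ‖e (k : K)‖ < 1) →
            ∃ (ΩK : ℂ) (Ωp : ℂ_[p]) (Q : PowerSeries 𝓞_ℂ_[p]), ΩK ≠ 0 ∧ ‖Ωp‖ = 1 ∧
              R1.IsBDPLFunctionInt p ι' (primeOfEmbeddingDatum p ι' w₀.embedding) κ γ Dt.f ΩK Ωp Q ∧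
              ∀ (𝔭bar : HeightOneSpectrum (𝓞 K)), ((p : ℕ) : 𝓞 K) ∈ 𝔭bar.asIdeal →
                𝔭bar ≠ primeOfEmbeddingDatum p ι' w₀.embedding →
                (XAc.charIdeal (W.baseChange K) p κ 𝔭bar ∅ γ).map (PowerSeries.map (R1.toCpInt p)) ≤
                  Ideal.span {Q} := by
  intro N _ K _ _ Dt H ι P hX h5 hs hN hK hodd hd3 hpd hμK hHN hLt hP hc hPinf κ hκ γ _ ι' w₀ P' hP' e he
  obtain ⟨ΩK, Ωp, L, hΩK, hL⟩ :=
    hFRAME N K Dt H ι P hX h5 hs hN hK hodd hpd hμK hHN hLt hP hc hPinf κ hκ γ ι' w₀ P' hP' e he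
  have hle : ∀ 𝔮 ∈ {𝔮 : HeightOneSpectrum (𝓞 K) | ((p : ℕ) : 𝓞 K) ∈ 𝔮.asIdeal ∧
      𝔮 ≠ primeOfEmbeddingDatum p ι' w₀.embedding},
      (XAc.charIdeal (W.baseChange K) p κ 𝔮 ∅ γ).map (PowerSeries.map (toUnr p)) ≤ Ideal.span {L} := by
    intro 𝔮 h𝔮
    obtain ⟨h𝔮p, hne⟩ := h𝔮
    have hub : ∃ k : ℕ, C (((p : ℕ) : unrIntegers p) ^ k) * L ∈
        (XAc.charIdeal (W.baseChange K) p κ 𝔮 ∅ γ).map (PowerSeries.map (toUnr p)) :=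
      ⟨0, by
        rw [pow_zero, map_one, one_mul]
        exact hUB N K Dt H ι P hX h5 hs hN hK hodd hd3 hpd hμK hHN hLt hP hc hPinf κ hκ γ ι' w₀ P' hP' e he
          ΩK Ωp L hΩK hL 𝔮 h𝔮p hne⟩
    exact (P2.charIdeal_map_eq_span_of_ratUpperBound_of_invariantsMatch κ γ 𝔮 hub
      (hINV N K Dt H ι P hX h5 hs hN hK hodd hd3 hpd hμK hHN hLt hP hc hPinf κ hκ γ ι' w₀ P' hP' e he ΩK Ωp L
        hΩK hL 𝔮 h𝔮p hne)).le
  obtain ⟨ΩK₁, Ωp₁, Q, hΩK₁, hΩp₁, hQ, hdiv⟩ :=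
    P2.exists_intFrame_forall_of_unrFrame_of_forall_le W p κ γ ι' (primeOfEmbeddingDatum p ι' w₀.embedding)
      Dt.f _ hΩK hL hle
  exact ⟨ΩK₁, Ωp₁, Q, hΩK₁, hΩp₁, hQ, fun 𝔭bar h𝔭bar hne ↦ hdiv 𝔭bar ⟨h𝔭bar, hne⟩⟩

/-! ### §4 The atom's display at every guarded datum ⟸ {BCS25 Thm 1.2.4 (b), Prop 4.2.2} + FRAME + UB♯|ᵍ +
TRANSFER|ᵍ -/

/-- **ROAD B12 at `p ≥ 5`, classical data, every admissible `K ≠ ℚ(√−3)`: (2.4)∃♭ᴮ's display ⟸ {BCS25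
Thm 1.2.4 (b), Prop 4.2.2 (PRINT)} + FRAME + UB♯|ᵍ + TRANSFER|ᵍ** — §1 supplies INV|ᵍ, §3 composes. FRAME is
print on every pair (Hsieh 2014 Thm 5.6 + BDP13 Thm 5.5: p512577's `P2.unrFrame_of_hsieh2014_unrPeriod_of_bdp2013`,
not imported here to stay clear of the route cone), so the deciding unprinted content of the classical residuals
along ROAD B12 at `K ≠ ℚ(√−3)` is UB♯ + TRANSFER exactly. CONDITIONAL; nothing booked.
[cite: BurungaleCastellaSkinner2025, Thm. 1.2.4 (b) and Prop. 4.2.2 (arXiv:2405.00270v2 pp. 3, 8–9)]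
[cite: Castella2018Erratum, (2.4) (p. 4) (the atom's display)] [cite: Washington1997, §7.1 Prop. 7.2 and §13.2] -/
theorem P2.imcDivSomeFrameB_guarded_of_thm124b_of_unrFrame_of_upperDivisibility_of_transfer
    (h124 : BurungaleCastellaSkinner2025.thm124b_exists_isBDPLFunction_isTorsion_charIdeal_eq)
    (h422 : BurungaleCastellaSkinner2025.prop422_exists_isBDPLFunction_mu_eq_zero)
    (hFRAME : ∀ (N : ℕ) [NeZero N] (K : Type) [Field K] [NumberField K]
      (Dt : ModularParametrizationData W N) (H : HeegnerDatum N (NumberField.discr K)) (ι : K →+* ℂ)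
      (P : (W.baseChange K).toAffine.Point),
      ClassX11b W p → 5 ≤ p → Surj W p → W.conductorNorm ℤ = N → IsImaginaryQuadratic K →
      Odd (NumberField.discr K) → ¬ (p : ℤ) ∣ NumberField.discr K → ¬ p ∣ Units.torsionOrder K →
      SatisfiesHeegnerHypothesis N K →
      (W.quadraticTwist (NumberField.discr K : ℚ)).entireLFunction 1 ≠ 0 →
      WeierstrassCurve.Affine.Point.map ι.toRatAlgHom P = heegnerPointComplex Dt H →
      ¬ (p : ℤ) ∣ Dt.c → ¬ IsOfFinAddOrder P →
      ∀ (κ : ZpExtension K p), κ.IsAnticyclotomic →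
        ∀ (γ : Field.absoluteGaloisGroup K) [Fact (κ.IsTopGenerator γ)]
          (ι' : PadicAlgCl p ≃+* ℂ) (w₀ : InfinitePlace K) (P' : (W.baseChange K).toAffine.Point),
          WeierstrassCurve.Affine.Point.map w₀.embedding.toRatAlgHom P' = heegnerPointComplex Dt H →
          ∀ (e : K →+* ℚ_[p]),
            (∀ k : 𝓞 K, k ∈ (primeOfEmbeddingDatum p ι' w₀.embedding).asIdeal ↔ ‖e (k : K)‖ < 1) →
            ∃ (ΩK : ℂ) (Ωp : (unrIntegers p)ˣ) (L : UnrSeries p), ΩK ≠ 0 ∧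
              IsBDPLFunction ι' (primeOfEmbeddingDatum p ι' w₀.embedding) κ γ Dt.f ΩK
                ((Ωp : unrIntegers p) : ℂ_[p]) L)
    (hUB : ∀ (N : ℕ) [NeZero N] (K : Type) [Field K] [NumberField K]
      (Dt : ModularParametrizationData W N) (H : HeegnerDatum N (NumberField.discr K)) (ι : K →+* ℂ)
      (P : (W.baseChange K).toAffine.Point),
      ClassX11b W p → 5 ≤ p → Surj W p → W.conductorNorm ℤ = N → IsImaginaryQuadratic K →
      Odd (NumberField.discr K) → NumberField.discr K ≠ -3 → ¬ (p : ℤ) ∣ NumberField.discr K →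
      ¬ p ∣ Units.torsionOrder K → SatisfiesHeegnerHypothesis N K →
      (W.quadraticTwist (NumberField.discr K : ℚ)).entireLFunction 1 ≠ 0 →
      WeierstrassCurve.Affine.Point.map ι.toRatAlgHom P = heegnerPointComplex Dt H →
      ¬ (p : ℤ) ∣ Dt.c → ¬ IsOfFinAddOrder P →
      ∀ (κ : ZpExtension K p), κ.IsAnticyclotomic →
        ∀ (γ : Field.absoluteGaloisGroup K) [Fact (κ.IsTopGenerator γ)]
          (ι' : PadicAlgCl p ≃+* ℂ) (w₀ : InfinitePlace K) (P' : (W.baseChange K).toAffine.Point),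
          WeierstrassCurve.Affine.Point.map w₀.embedding.toRatAlgHom P' = heegnerPointComplex Dt H →
          ∀ (e : K →+* ℚ_[p]),
            (∀ k : 𝓞 K, k ∈ (primeOfEmbeddingDatum p ι' w₀.embedding).asIdeal ↔ ‖e (k : K)‖ < 1) →
            ∀ (ΩK : ℂ) (Ωp : (unrIntegers p)ˣ) (L : UnrSeries p), ΩK ≠ 0 →
              IsBDPLFunction ι' (primeOfEmbeddingDatum p ι' w₀.embedding) κ γ Dt.f ΩK
                ((Ωp : unrIntegers p) : ℂ_[p]) L →
              ∀ (𝔭bar : HeightOneSpectrum (𝓞 K)), ((p : ℕ) : 𝓞 K) ∈ 𝔭bar.asIdeal →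
                𝔭bar ≠ primeOfEmbeddingDatum p ι' w₀.embedding →
                L ∈ (XAc.charIdeal (W.baseChange K) p κ 𝔭bar ∅ γ).map (PowerSeries.map (toUnr p)))
    (hTR : ∀ (N : ℕ) [NeZero N] (K : Type) [Field K] [NumberField K]
      (Dt : ModularParametrizationData W N) (H : HeegnerDatum N (NumberField.discr K)) (ι : K →+* ℂ)
      (P : (W.baseChange K).toAffine.Point),
      ClassX11b W p → 5 ≤ p → Surj W p → W.conductorNorm ℤ = N → IsImaginaryQuadratic K →
      Odd (NumberField.discr K) → NumberField.discr K ≠ -3 → ¬ (p : ℤ) ∣ NumberField.discr K →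
      ¬ p ∣ Units.torsionOrder K → SatisfiesHeegnerHypothesis N K →
      (W.quadraticTwist (NumberField.discr K : ℚ)).entireLFunction 1 ≠ 0 →
      WeierstrassCurve.Affine.Point.map ι.toRatAlgHom P = heegnerPointComplex Dt H →
      ¬ (p : ℤ) ∣ Dt.c → ¬ IsOfFinAddOrder P →
      ∀ (κ : ZpExtension K p), κ.IsAnticyclotomic →
        ∀ (γ : Field.absoluteGaloisGroup K) [Fact (κ.IsTopGenerator γ)]
          (ι' : PadicAlgCl p ≃+* ℂ) (w₀ : InfinitePlace K) (P' : (W.baseChange K).toAffine.Point),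
          WeierstrassCurve.Affine.Point.map w₀.embedding.toRatAlgHom P' = heegnerPointComplex Dt H →
          ∀ (e : K →+* ℚ_[p]),
            (∀ k : 𝓞 K, k ∈ (primeOfEmbeddingDatum p ι' w₀.embedding).asIdeal ↔ ‖e (k : K)‖ < 1) →
            ∀ (ΩK : ℂ) (Ωp : (unrIntegers p)ˣ) (L : UnrSeries p), ΩK ≠ 0 →
              IsBDPLFunction ι' (primeOfEmbeddingDatum p ι' w₀.embedding) κ γ Dt.f ΩK
                ((Ωp : unrIntegers p) : ℂ_[p]) L →
              ∀ (𝔭bar : HeightOneSpectrum (𝓞 K)), ((p : ℕ) : 𝓞 K) ∈ 𝔭bar.asIdeal →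
                𝔭bar ≠ primeOfEmbeddingDatum p ι' w₀.embedding →
                ∃ (W' : WeierstrassCurve ℚ) (_ : W'.IsElliptic) (_ : W'.IsGloballyMinimal) (N' : ℕ)
                  (_ : NeZero N') (Dt' : ModularParametrizationData W' N'),
                  GoodOrd W' p ∧ Surj W' p ∧ SatisfiesHeegnerHypothesis N' K ∧
                  ∀ (g g' : IwasawaAlgebra p),
                    XAc.charIdeal (W.baseChange K) p κ 𝔭bar ∅ γ = Ideal.span {g} →
                    XAc.charIdeal (W'.baseChange K) p κ 𝔭bar ∅ γ = Ideal.span {g'} →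
                    ∀ (ΩK' : ℂ) (Ωp' : (unrIntegers p)ˣ) (L' : UnrSeries p), ΩK' ≠ 0 →
                      IsBDPLFunction ι' (primeOfEmbeddingDatum p ι' w₀.embedding) κ γ Dt'.f ΩK'
                        ((Ωp' : unrIntegers p) : ℂ_[p]) L' →
                      ∃ (P P' u : UnrSeries p) (m m' : ℕ),
                        (‖((coeff m P : unrIntegers p) : ℂ_[p])‖ = 1 ∧
                          ∀ i < m, ‖((coeff i P : unrIntegers p) : ℂ_[p])‖ < 1) ∧
                        (‖((coeff m' P' : unrIntegers p) : ℂ_[p])‖ = 1 ∧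
                          ∀ i < m', ‖((coeff i P' : unrIntegers p) : ℂ_[p])‖ < 1) ∧
                        IsUnit u ∧
                        (∀ i, ‖((coeff i (u * (L' * P')) : unrIntegers p) : ℂ_[p]) -
                          ((coeff i (L * P) : unrIntegers p) : ℂ_[p])‖ < 1) ∧
                        ((∃ a, (‖((coeff a (PowerSeries.map (toUnr p) g * P) : unrIntegers p) : ℂ_[p])‖ = 1 ∧
                            ∀ i < a, ‖((coeff i (PowerSeries.map (toUnr p) g * P) : unrIntegers p) :
                              ℂ_[p])‖ < 1)) →
                          ∃ a', (‖((coeff a' (PowerSeries.map (toUnr p) g' * P') : unrIntegers p) : ℂ_[p])‖ = 1 ∧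
                            ∀ i < a', ‖((coeff i (PowerSeries.map (toUnr p) g' * P') : unrIntegers p) :
                              ℂ_[p])‖ < 1)) ∧
                        (∀ a a', (‖((coeff a (PowerSeries.map (toUnr p) g * P) : unrIntegers p) : ℂ_[p])‖ = 1 ∧
                            ∀ i < a, ‖((coeff i (PowerSeries.map (toUnr p) g * P) : unrIntegers p) :
                              ℂ_[p])‖ < 1) →
                          (‖((coeff a' (PowerSeries.map (toUnr p) g' * P') : unrIntegers p) : ℂ_[p])‖ = 1 ∧
                            ∀ i < a', ‖((coeff i (PowerSeries.map (toUnr p) g' * P') : unrIntegers p) :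
                              ℂ_[p])‖ < 1) → a = a')) :
    ∀ (N : ℕ) [NeZero N] (K : Type) [Field K] [NumberField K]
      (Dt : ModularParametrizationData W N) (H : HeegnerDatum N (NumberField.discr K)) (ι : K →+* ℂ)
      (P : (W.baseChange K).toAffine.Point),
      ClassX11b W p → 5 ≤ p → Surj W p → W.conductorNorm ℤ = N → IsImaginaryQuadratic K →
      Odd (NumberField.discr K) → NumberField.discr K ≠ -3 → ¬ (p : ℤ) ∣ NumberField.discr K →
      ¬ p ∣ Units.torsionOrder K → SatisfiesHeegnerHypothesis N K →
      (W.quadraticTwist (NumberField.discr K : ℚ)).entireLFunction 1 ≠ 0 →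
      WeierstrassCurve.Affine.Point.map ι.toRatAlgHom P = heegnerPointComplex Dt H →
      ¬ (p : ℤ) ∣ Dt.c → ¬ IsOfFinAddOrder P →
      ∀ (κ : ZpExtension K p), κ.IsAnticyclotomic →
        ∀ (γ : Field.absoluteGaloisGroup K) [Fact (κ.IsTopGenerator γ)]
          (ι' : PadicAlgCl p ≃+* ℂ) (w₀ : InfinitePlace K) (P' : (W.baseChange K).toAffine.Point),
          WeierstrassCurve.Affine.Point.map w₀.embedding.toRatAlgHom P' = heegnerPointComplex Dt H →
          ∀ (e : K →+* ℚ_[p]),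
            (∀ k : 𝓞 K, k ∈ (primeOfEmbeddingDatum p ι' w₀.embedding).asIdeal ↔ ‖e (k : K)‖ < 1) →
            ∃ (ΩK : ℂ) (Ωp : ℂ_[p]) (Q : PowerSeries 𝓞_ℂ_[p]), ΩK ≠ 0 ∧ ‖Ωp‖ = 1 ∧
              R1.IsBDPLFunctionInt p ι' (primeOfEmbeddingDatum p ι' w₀.embedding) κ γ Dt.f ΩK Ωp Q ∧
              ∀ (𝔭bar : HeightOneSpectrum (𝓞 K)), ((p : ℕ) : 𝓞 K) ∈ 𝔭bar.asIdeal →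
                𝔭bar ≠ primeOfEmbeddingDatum p ι' w₀.embedding →
                (XAc.charIdeal (W.baseChange K) p κ 𝔭bar ∅ γ).map (PowerSeries.map (R1.toCpInt p)) ≤
                  Ideal.span {Q} :=
  P2.imcDivSomeFrameB_guarded_of_unrFrame_of_upperDivisibility_of_invariantsMatch hFRAME hUB
    (P2.invariantsMatch_guarded_of_thm124b_of_upperDivisibility_of_transfer h124 h422 hUB hTR)

end Summit.BirchSwinnertonDyer.Rank1Residual.X11b

end
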